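import Summits.HodgeConjecture.CorCM.Census.CentralSquaresChosenCover

/-!
# The square-central class, XXIX: admissible choices with THREE prescribed blocks

COR-CM (cell `pub-hodgecm2`), count-neutral kernel combinatorics by the binder seat b09 (gen 46; lane SQUARE-CENTRAL CLASS, part XXIX), on part XIII
(`Census/CentralSquaresChosenCover.lean`: `exists_admissible_choice`, `exists_chosen_strict_lowering_cover`, `isLeast_card_gfaces_generate_of_chosen_cover_closure`)
and gen 38ʼs `exists_choice`, BY NAME.  Theorems only: no definition, no `decide`, no certificate, no named fact, no `sorry`.  HONEST FRAMING: `HC_CM` is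
NOT proved, here or anywhere in the tree; nothing here is a period or a headline.

WHY (design note `CENTRAL-SQUARES-M2.md` §5, numerics `lean-g46/py/z4z4seeds.py`, `z4z4blocks3.py`): in the order-`4` swap rows (`ℤ/4 ⋊ ℤ/4`) the mixed
designated face at the level-`4` type `Φ = {T ∣ A}` closes the residual lattice (up to `4`) ONLY IF the strict cover resolves the tie corner `Φ^{(k)}` toward
`T₁` AND the tie corner `Φ^{(h)}` toward `T̄₀` (the combinations `(T₀, T̄₀)` and `(T₁, T₁)` fail: near rank `8/10`, `6/10`); the two corners lie in two
different level-`3` blocks (the block of `T ∪ {κ}`, `κ ∈ 𝓗ᶜ`, and the block of `(𝓗 ∖ T) ∪ {κ}`).  Part XIIIʼs admissible choice `τ : Block → G × G × G` is free at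
every block — lowering everywhere, strict wherever a strict triple exists — so THREE prescriptions are admissible: a lowering triple at a block `B₀` without
strict triples and STRICT triples at two further blocks `B₁ ≠ B₂`.

* `exists_admissible_choice₃`: the three-block version of part XIII §3 (`τ B₀ = τ₀`, `τ B₁ = τ₁`, `τ B₂ = τ₂`, lowering everywhere, strict wherever possible).

## References
* [Pohlmann1968] H. Pohlmann, Algebraic cycles on abelian varieties of complex multiplication type, Ann. of Math. 88 (1968), Thm 1.
-/

namespace Summit.HodgeConjecture.CorCM.Census.CoverClosure

open Finset
open Summit.HodgeConjecture.CorCM.Prior.AllgGroup.RfwfAllgGroup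
open Summit.HodgeConjecture.CorCM.Census.BlockParity
open Summit.HodgeConjecture.CorCM.Census.Coinvariant
open Summit.HodgeConjecture.CorCM.Census.TwistGeneration
open Summit.HodgeConjecture.CorCM.Census.BaseBlock

noncomputable section

variable {G : Type*} [Group G] [Fintype G] [DecidableEq G] (c : G) (T₀ : CMF G c)

/-- **An admissible choice with three prescribed blocks.**  At a far block `B₀` without strict triples prescribe a lowering triple `τ₀`; at two further
blocks `B₁`, `B₂` (distinct, and distinct from `B₀`) prescribe STRICT lowering triples `τ₁`, `τ₂`; elsewhere choose as in part XIII.  The resulting `τ` is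
lowering at every far block and strict wherever a strict triple exists. [folklore] -/
theorem exists_admissible_choice₃ (hc2 : c * c = 1) (B₀ B₁ B₂ : Block c) (τ₀ τ₁ τ₂ : G × G × G)
    (h10 : B₁ ≠ B₀) (h20 : B₂ ≠ B₀) (h21 : B₂ ≠ B₁)
    (h₀ : bpot c T₀ B₀.out = ddist (rt c τ₀.1 T₀) B₀.out ∧
      τ₀.2.1 ∈ (rt c τ₀.1 T₀).1 \ B₀.out.1 ∧ τ₀.2.2 ∈ (rt c τ₀.1 T₀).1 \ B₀.out.1 ∧ τ₀.2.1 ≠ τ₀.2.2)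
    (h₀ns : ¬ ∃ Q₁ t t' : G, bpot c T₀ B₀.out = ddist (rt c Q₁ T₀) B₀.out ∧
        t ∈ (rt c Q₁ T₀).1 \ B₀.out.1 ∧ t' ∈ (rt c Q₁ T₀).1 \ B₀.out.1 ∧ t ≠ t' ∧
        (∀ Q' : G, ddist (rt c Q' T₀) (oflipCM c hc2 t B₀.out) = bpot c T₀ (oflipCM c hc2 t B₀.out) → rt c Q' T₀ = rt c Q₁ T₀) ∧
        (∀ Q' : G, ddist (rt c Q' T₀) (oflipCM c hc2 t' B₀.out) = bpot c T₀ (oflipCM c hc2 t' B₀.out) → rt c Q' T₀ = rt c Q₁ T₀) ∧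
        (∀ Q' : G, ddist (rt c Q' T₀) (oflipCM c hc2 t (oflipCM c hc2 t' B₀.out)) = bpot c T₀ (oflipCM c hc2 t (oflipCM c hc2 t' B₀.out)) →
          rt c Q' T₀ = rt c Q₁ T₀))
    (h₁ : bpot c T₀ B₁.out = ddist (rt c τ₁.1 T₀) B₁.out ∧
      τ₁.2.1 ∈ (rt c τ₁.1 T₀).1 \ B₁.out.1 ∧ τ₁.2.2 ∈ (rt c τ₁.1 T₀).1 \ B₁.out.1 ∧ τ₁.2.1 ≠ τ₁.2.2 ∧
      (∀ Q' : G, ddist (rt c Q' T₀) (oflipCM c hc2 τ₁.2.1 B₁.out) = bpot c T₀ (oflipCM c hc2 τ₁.2.1 B₁.out) → rt c Q' T₀ = rt c τ₁.1 T₀) ∧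
      (∀ Q' : G, ddist (rt c Q' T₀) (oflipCM c hc2 τ₁.2.2 B₁.out) = bpot c T₀ (oflipCM c hc2 τ₁.2.2 B₁.out) → rt c Q' T₀ = rt c τ₁.1 T₀) ∧
      (∀ Q' : G, ddist (rt c Q' T₀) (oflipCM c hc2 τ₁.2.1 (oflipCM c hc2 τ₁.2.2 B₁.out)) =
          bpot c T₀ (oflipCM c hc2 τ₁.2.1 (oflipCM c hc2 τ₁.2.2 B₁.out)) → rt c Q' T₀ = rt c τ₁.1 T₀))
    (h₂ : bpot c T₀ B₂.out = ddist (rt c τ₂.1 T₀) B₂.out ∧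
      τ₂.2.1 ∈ (rt c τ₂.1 T₀).1 \ B₂.out.1 ∧ τ₂.2.2 ∈ (rt c τ₂.1 T₀).1 \ B₂.out.1 ∧ τ₂.2.1 ≠ τ₂.2.2 ∧
      (∀ Q' : G, ddist (rt c Q' T₀) (oflipCM c hc2 τ₂.2.1 B₂.out) = bpot c T₀ (oflipCM c hc2 τ₂.2.1 B₂.out) → rt c Q' T₀ = rt c τ₂.1 T₀) ∧
      (∀ Q' : G, ddist (rt c Q' T₀) (oflipCM c hc2 τ₂.2.2 B₂.out) = bpot c T₀ (oflipCM c hc2 τ₂.2.2 B₂.out) → rt c Q' T₀ = rt c τ₂.1 T₀) ∧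
      (∀ Q' : G, ddist (rt c Q' T₀) (oflipCM c hc2 τ₂.2.1 (oflipCM c hc2 τ₂.2.2 B₂.out)) =
          bpot c T₀ (oflipCM c hc2 τ₂.2.1 (oflipCM c hc2 τ₂.2.2 B₂.out)) → rt c Q' T₀ = rt c τ₂.1 T₀)) :
    ∃ τ : Block c → G × G × G, τ B₀ = τ₀ ∧ τ B₁ = τ₁ ∧ τ B₂ = τ₂ ∧
      (∀ Bk : Block c, 2 ≤ bpot c T₀ Bk.out →
        bpot c T₀ Bk.out = ddist (rt c (τ Bk).1 T₀) Bk.out ∧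
          (τ Bk).2.1 ∈ (rt c (τ Bk).1 T₀).1 \ Bk.out.1 ∧ (τ Bk).2.2 ∈ (rt c (τ Bk).1 T₀).1 \ Bk.out.1 ∧ (τ Bk).2.1 ≠ (τ Bk).2.2) ∧
      (∀ Bk : Block c, (∃ Q₁ t t' : G, bpot c T₀ Bk.out = ddist (rt c Q₁ T₀) Bk.out ∧
          t ∈ (rt c Q₁ T₀).1 \ Bk.out.1 ∧ t' ∈ (rt c Q₁ T₀).1 \ Bk.out.1 ∧ t ≠ t' ∧
          (∀ Q' : G, ddist (rt c Q' T₀) (oflipCM c hc2 t Bk.out) = bpot c T₀ (oflipCM c hc2 t Bk.out) → rt c Q' T₀ = rt c Q₁ T₀) ∧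
          (∀ Q' : G, ddist (rt c Q' T₀) (oflipCM c hc2 t' Bk.out) = bpot c T₀ (oflipCM c hc2 t' Bk.out) → rt c Q' T₀ = rt c Q₁ T₀) ∧
          (∀ Q' : G, ddist (rt c Q' T₀) (oflipCM c hc2 t (oflipCM c hc2 t' Bk.out)) = bpot c T₀ (oflipCM c hc2 t (oflipCM c hc2 t' Bk.out)) →
            rt c Q' T₀ = rt c Q₁ T₀)) →
        bpot c T₀ Bk.out = ddist (rt c (τ Bk).1 T₀) Bk.out ∧
          (τ Bk).2.1 ∈ (rt c (τ Bk).1 T₀).1 \ Bk.out.1 ∧ (τ Bk).2.2 ∈ (rt c (τ Bk).1 T₀).1 \ Bk.out.1 ∧ (τ Bk).2.1 ≠ (τ Bk).2.2 ∧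
          (∀ Q' : G, ddist (rt c Q' T₀) (oflipCM c hc2 (τ Bk).2.1 Bk.out) = bpot c T₀ (oflipCM c hc2 (τ Bk).2.1 Bk.out) →
            rt c Q' T₀ = rt c (τ Bk).1 T₀) ∧
          (∀ Q' : G, ddist (rt c Q' T₀) (oflipCM c hc2 (τ Bk).2.2 Bk.out) = bpot c T₀ (oflipCM c hc2 (τ Bk).2.2 Bk.out) →
            rt c Q' T₀ = rt c (τ Bk).1 T₀) ∧
          (∀ Q' : G, ddist (rt c Q' T₀) (oflipCM c hc2 (τ Bk).2.1 (oflipCM c hc2 (τ Bk).2.2 Bk.out)) =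
              bpot c T₀ (oflipCM c hc2 (τ Bk).2.1 (oflipCM c hc2 (τ Bk).2.2 Bk.out)) → rt c Q' T₀ = rt c (τ Bk).1 T₀)) := by
  classical
  have hch : ∀ Bk : Block c, ∃ σ : G × G × G, (Bk = B₀ → σ = τ₀) ∧ (Bk = B₁ → σ = τ₁) ∧ (Bk = B₂ → σ = τ₂) ∧ (2 ≤ bpot c T₀ Bk.out →
      bpot c T₀ Bk.out = ddist (rt c σ.1 T₀) Bk.out ∧
        σ.2.1 ∈ (rt c σ.1 T₀).1 \ Bk.out.1 ∧ σ.2.2 ∈ (rt c σ.1 T₀).1 \ Bk.out.1 ∧ σ.2.1 ≠ σ.2.2) ∧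
      ((∃ Q₁ t t' : G, bpot c T₀ Bk.out = ddist (rt c Q₁ T₀) Bk.out ∧
          t ∈ (rt c Q₁ T₀).1 \ Bk.out.1 ∧ t' ∈ (rt c Q₁ T₀).1 \ Bk.out.1 ∧ t ≠ t' ∧
          (∀ Q' : G, ddist (rt c Q' T₀) (oflipCM c hc2 t Bk.out) = bpot c T₀ (oflipCM c hc2 t Bk.out) → rt c Q' T₀ = rt c Q₁ T₀) ∧
          (∀ Q' : G, ddist (rt c Q' T₀) (oflipCM c hc2 t' Bk.out) = bpot c T₀ (oflipCM c hc2 t' Bk.out) → rt c Q' T₀ = rt c Q₁ T₀) ∧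
          (∀ Q' : G, ddist (rt c Q' T₀) (oflipCM c hc2 t (oflipCM c hc2 t' Bk.out)) = bpot c T₀ (oflipCM c hc2 t (oflipCM c hc2 t' Bk.out)) →
            rt c Q' T₀ = rt c Q₁ T₀)) →
        bpot c T₀ Bk.out = ddist (rt c σ.1 T₀) Bk.out ∧
          σ.2.1 ∈ (rt c σ.1 T₀).1 \ Bk.out.1 ∧ σ.2.2 ∈ (rt c σ.1 T₀).1 \ Bk.out.1 ∧ σ.2.1 ≠ σ.2.2 ∧
          (∀ Q' : G, ddist (rt c Q' T₀) (oflipCM c hc2 σ.2.1 Bk.out) = bpot c T₀ (oflipCM c hc2 σ.2.1 Bk.out) → rt c Q' T₀ = rt c σ.1 T₀) ∧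
          (∀ Q' : G, ddist (rt c Q' T₀) (oflipCM c hc2 σ.2.2 Bk.out) = bpot c T₀ (oflipCM c hc2 σ.2.2 Bk.out) → rt c Q' T₀ = rt c σ.1 T₀) ∧
          (∀ Q' : G, ddist (rt c Q' T₀) (oflipCM c hc2 σ.2.1 (oflipCM c hc2 σ.2.2 Bk.out)) =
              bpot c T₀ (oflipCM c hc2 σ.2.1 (oflipCM c hc2 σ.2.2 Bk.out)) → rt c Q' T₀ = rt c σ.1 T₀)) := by
    intro Bk
    by_cases hB0 : Bk = B₀
    · subst hB0
      exact ⟨τ₀, fun _ => rfl, fun h => absurd h.symm h10, fun h => absurd h.symm h20, fun _ => h₀, fun hex => absurd hex h₀ns⟩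
    · by_cases hB1 : Bk = B₁
      · subst hB1
        obtain ⟨h1, ht, ht', htt', hu1, hu2, hu3⟩ := h₁
        exact ⟨τ₁, fun h => absurd h hB0, fun _ => rfl, fun h => absurd h.symm h21, fun _ => ⟨h1, ht, ht', htt'⟩,
          fun _ => ⟨h1, ht, ht', htt', hu1, hu2, hu3⟩⟩
      · by_cases hB2 : Bk = B₂
        · subst hB2
          obtain ⟨h1, ht, ht', htt', hu1, hu2, hu3⟩ := h₂
          exact ⟨τ₂, fun h => absurd h hB0, fun h => absurd h hB1, fun _ => rfl, fun _ => ⟨h1, ht, ht', htt'⟩,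
            fun _ => ⟨h1, ht, ht', htt', hu1, hu2, hu3⟩⟩
        · by_cases hs : ∃ Q₁ t t' : G, bpot c T₀ Bk.out = ddist (rt c Q₁ T₀) Bk.out ∧
              t ∈ (rt c Q₁ T₀).1 \ Bk.out.1 ∧ t' ∈ (rt c Q₁ T₀).1 \ Bk.out.1 ∧ t ≠ t' ∧
              (∀ Q' : G, ddist (rt c Q' T₀) (oflipCM c hc2 t Bk.out) = bpot c T₀ (oflipCM c hc2 t Bk.out) → rt c Q' T₀ = rt c Q₁ T₀) ∧
              (∀ Q' : G, ddist (rt c Q' T₀) (oflipCM c hc2 t' Bk.out) = bpot c T₀ (oflipCM c hc2 t' Bk.out) → rt c Q' T₀ = rt c Q₁ T₀) ∧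
              (∀ Q' : G, ddist (rt c Q' T₀) (oflipCM c hc2 t (oflipCM c hc2 t' Bk.out)) = bpot c T₀ (oflipCM c hc2 t (oflipCM c hc2 t' Bk.out)) →
                rt c Q' T₀ = rt c Q₁ T₀)
          · obtain ⟨Q₁, t, t', h1, ht, ht', htt', hu1, hu2, hu3⟩ := hs
            exact ⟨(Q₁, t, t'), fun h => absurd h hB0, fun h => absurd h hB1, fun h => absurd h hB2, fun _ => ⟨h1, ht, ht', htt'⟩,
              fun _ => ⟨h1, ht, ht', htt', hu1, hu2, hu3⟩⟩
          · by_cases h : 2 ≤ bpot c T₀ Bk.out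
            · obtain ⟨Q, t, t', h1, h3, h4, h5⟩ := exists_choice c T₀ Bk.out h
              exact ⟨(Q, t, t'), fun h' => absurd h' hB0, fun h' => absurd h' hB1, fun h' => absurd h' hB2, fun _ => ⟨h1, h3, h4, h5⟩,
                fun h' => absurd h' hs⟩
            · exact ⟨(1, 1, 1), fun h' => absurd h' hB0, fun h' => absurd h' hB1, fun h' => absurd h' hB2, fun h' => absurd h' h,
                fun h' => absurd h' hs⟩
  choose τ hτ₀ hτ₁ hτ₂ hτlow hτstr using hch
  exact ⟨τ, hτ₀ B₀ rfl, hτ₁ B₁ rfl, hτ₂ B₂ rfl, hτlow, hτstr⟩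

end

end Summit.HodgeConjecture.CorCM.Census.CoverClosure
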